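import Literature.Computability.Cryptography.RegevSamplerWordFns
import Literature.Computability.QuantumComplexity.CleanXorGadget
import HarnessLib

/-!
# Regev 2009, Lemma 3.14 in machine form: the classical stage of the sampler (three clean XOR blocks, two oracle calls)

Topic `Computability/Cryptography` (family `pqc`), grouping namespace `Regev2009.SamplerClassical`; sequel of
`RegevSamplerWordFns.lean` (the block functions `FY`/`FS`/`FX` of the branch, residue and erasing words,
their machines) on top of `QuantumComplexity/CleanXorGadget.lean` (the exact garbage-free oracle
`|x⟩|y⟩ ↦ |x⟩|y ⊕ F(x)⟩` of a polynomial-time `F`: `CleanXor.ops`, `clEval_ops_target`, `clEval_ops_of_ne`).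
Regev's sampler (J. ACM 56 (2009), art. 34, proof of Lemma 3.14), after the Gaussian state on the point
register `X` has been prepared, runs CLASSICALLY (coherently, on basis labels):

  `Y ⊕= branch(X)` · `S ⊕= residues(X)` · `A ⊕= CVP-oracle(query)` · `X ⊕= recompose(Y, S, A)` · `A ⊕= CVP-oracle(query)`

("compute `x mod P(L*)` in a second register … using the CVP oracle, we can recover `x` … this allows
us to uncompute the first register"; the second call clears the oracle's answer, the query — the input
prefix and the residue table — being untouched in between). This file builds that stage over an
abstract LAYOUT (`Layout`: the zones `X, U, Y, S, A` of the big register as consecutive index ranges of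
one injective placement `loc`, all below the base of a shared work window; the input zone `U` holds the
pre-processed input `F_q ++ ⟨⟨P_all⟩, ε⟩ ++ pad` off which the blocks read the instance parameters) and
an abstract ORACLE (any basis map acting as `oracleAct f`: XOR of `f(query)` onto the answer zone), and
computes its action on labels:

* `Layout W n` (the dimension `n` a parameter), `Layout.OK`, offsets `oU/oY/oS/oA/T`, the wires `fin i`; the three programs `opsY`, `opsS`,
  `opsX` (`CleanXor.ops` with the machines of `RegevSamplerWordFns`), their geometry (`geomY/S/X` under
  `Fits`), `qry`, `oracleAct`, **`kappa`** (the label action of the whole stage);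
* **`kappa_spec`** — on a label carrying the point bits `xb` on `X`, the zone content on `U`, zeros on
  `Y, S, A` and above the base: after the stage `Y` holds the branch word, `S` the residue word (the
  query table), `A` is clean again, `U` and every other wire are unchanged, and `X` holds
  `xb ⊕ wordX(Y, S, f(query))` — which is `0…0` when the oracle answers well
  (`RegevSamplerWords.wordX_points`);
* the circuit: `circY/circS/circX` (`CleanXor.circuit`), `stageMat O = O·C_X·O·C_S·C_Y`,
  **`isBasisMap_stageMat`** (a basis map along `kappa` whenever `O` acts as `oracleAct f`),
  `stageMat_mem_unitaryGroup`, `circ_isOracleFree`.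

Everything is proved; definitions have bodies; no named fact is introduced.

## References

* O. Regev, *On lattices, learning with errors, random linear codes, and cryptography*, J. ACM 56
  (2009), art. 34; author's version arXiv:2401.03703: Lemma 3.14 (proof) [Regev2009].
* C. H. Bennett, *Logical reversibility of computation*, IBM J. Res. Develop. 17 (1973), §2 [Bennett1973].
* M. A. Nielsen, I. L. Chuang, *Quantum Computation and Quantum Information*, CUP 2010, §3.2.5
  (uncomputation), §6.1.1 (the XOR oracle) [NielsenChuang2010].
-/

noncomputable section

namespace Literature.Computability.Cryptography

namespace Regev2009

namespace SamplerClassical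

open Literature.Computability.Complexity Literature.Computability.QuantumComplexity
  Literature.Computability.QuantumComplexity.RevSim Literature.Computability.QuantumComplexity.RevClean
  SamplerWords SamplerWordFns Turing
open _root_.Computability

/-! ### The layout -/

/-- **The layout of the classical stage** on a `W`-wire register: sizes, the injective placement `loc` of
the zones `X = loc [0, nℓ)`, `U = loc [nℓ, nℓ+L)`, `Y`, `S`, `A` (consecutive index ranges), and the
base of the shared work window. [cite: Regev2009, Lemma 3.14 (proof: the registers)] -/
structure Layout (W n : ℕ) where
  /-- bits per coordinate of the point register -/
  ℓ : ℕ
  /-- bits per coordinate of the branch register -/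
  ℓY : ℕ
  /-- bits per residue (`R = 2^{ℓR}`) -/
  ℓR : ℕ
  /-- bits per answer coordinate -/
  bc : ℕ
  /-- length of the input zone -/
  L : ℕ
  /-- length of the query prefix (a prefix of the input zone) -/
  Lq : ℕ
  /-- the register is nonempty -/
  hW : 0 < W
  /-- the placement of the zones -/
  loc : ℕ → ℕ
  /-- base of the work window -/
  base : ℕ

namespace Layout

variable {W n : ℕ} (Λ : Layout W n)

/-- Offset of the input zone. [folklore] -/
def oU : ℕ := n * Λ.ℓ
/-- Offset of the branch zone. [folklore] -/
def oY : ℕ := Λ.oU + Λ.L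
/-- Offset of the residue zone. [folklore] -/
def oS : ℕ := Λ.oY + n * Λ.ℓY
/-- Offset of the answer zone. [folklore] -/
def oA : ℕ := Λ.oS + n * Λ.ℓR
/-- Total number of zone indices. [folklore] -/
def T : ℕ := Λ.oA + n * Λ.bc
/-- Length of the register part of the erasing block's data: `n·ℓY + n·ℓR + n·bc`. [folklore] -/
def regLen : ℕ := n * Λ.ℓY + n * Λ.ℓR + n * Λ.bc
/-- Width of the query: prefix and residue table. [folklore] -/
def kq : ℕ := Λ.Lq + n * Λ.ℓR

/-- **Well-formedness of a layout.** [folklore] -/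
structure OK : Prop where
  /-- the placement is injective on the zones -/
  loc_inj : ∀ i j, i < Λ.T → j < Λ.T → Λ.loc i = Λ.loc j → i = j
  /-- the zones lie below the work window -/
  loc_lt : ∀ i, i < Λ.T → Λ.loc i < Λ.base
  /-- the window starts inside the register -/
  base_le : Λ.base ≤ W
  /-- the query prefix is a prefix of the input zone -/
  Lq_le : Λ.Lq ≤ Λ.L
  /-- the input zone dominates the register sizes (padding of the pre-processed input) -/
  szX : n * Λ.ℓ ≤ Λ.L
  szY : n * Λ.ℓY ≤ Λ.L
  szS : n * Λ.ℓR ≤ Λ.L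

/-- Zone wire `i`. [folklore] -/
def fin (i : ℕ) : Fin W := finOf W Λ.hW (Λ.loc i)

variable {Λ} (hΛ : Λ.OK)
include hΛ

/-- Value of a zone wire. [folklore] -/
theorem fin_val {i : ℕ} (hi : i < Λ.T) : (Λ.fin i : ℕ) = Λ.loc i := val_finOf_of_lt Λ.hW ((hΛ.loc_lt i hi).trans_le hΛ.base_le)

/-- Zone wires are injective. [folklore] -/
theorem fin_inj {i j : ℕ} (hi : i < Λ.T) (hj : j < Λ.T) (h : Λ.fin i = Λ.fin j) : i = j :=
  hΛ.loc_inj i j hi hj (by rw [← fin_val hΛ hi, ← fin_val hΛ hj, h])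

/-- Zone wires lie below the base. [folklore] -/
theorem fin_lt_base {i : ℕ} (hi : i < Λ.T) : (Λ.fin i : ℕ) < Λ.base := by rw [fin_val hΛ hi]; exact hΛ.loc_lt i hi

omit hΛ in
/-- Offsets, unfolded. [folklore] -/
theorem T_eq : Λ.T = n * Λ.ℓ + Λ.L + n * Λ.ℓY + n * Λ.ℓR + n * Λ.bc := by
  unfold T oA oS oY oU; ring

end Layout

/-! ### The machines and the programs -/

/-- Time exponent of the branch machine. [folklore] -/
def eY : ℕ := SamplerWordFns.exists_machineY.choose
/-- **The branch machine.** [folklore] -/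
def MY : TM2ComputableAux Bool Bool := SamplerWordFns.exists_machineY.choose_spec.choose
/-- Its specification. [folklore] -/
theorem MY_spec (Q : QY) (d : List Bool) :
    MY.OutputsWithin (d ++ CleanBlockInput.suffix (qYE Q) d.length) (FY Q d) (Tn eY (d ++ CleanBlockInput.suffix (qYE Q) d.length).length) :=
  SamplerWordFns.exists_machineY.choose_spec.choose_spec Q d
/-- Time exponent of the residue machine. [folklore] -/
def eS : ℕ := SamplerWordFns.exists_machineS.choose
/-- **The residue machine.** [folklore] -/
def MS : TM2ComputableAux Bool Bool := SamplerWordFns.exists_machineS.choose_spec.choose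
/-- Its specification. [folklore] -/
theorem MS_spec (Q : QS) (d : List Bool) :
    MS.OutputsWithin (d ++ CleanBlockInput.suffix (qYE Q) d.length) (FS Q d) (Tn eS (d ++ CleanBlockInput.suffix (qYE Q) d.length).length) :=
  SamplerWordFns.exists_machineS.choose_spec.choose_spec Q d
/-- Time exponent of the erasing machine. [folklore] -/
def eX : ℕ := SamplerWordFns.exists_machineX.choose
/-- **The erasing machine.** [folklore] -/
def MX : TM2ComputableAux Bool Bool := SamplerWordFns.exists_machineX.choose_spec.choose
/-- Its specification. [folklore] -/
theorem MX_spec (Q : QX) (d : List Bool) :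
    MX.OutputsWithin (d ++ CleanBlockInput.suffix (qXE Q) d.length) (FX Q d) (Tn eX (d ++ CleanBlockInput.suffix (qXE Q) d.length).length) :=
  SamplerWordFns.exists_machineX.choose_spec.choose_spec Q d

variable {W n : ℕ} (Λ : Layout W n)

/-- Suffix parameters of the branch block. [folklore] -/
def QYof : QY := (n, (Λ.ℓ, (Λ.ℓY, Λ.Lq)))
/-- Suffix parameters of the residue block. [folklore] -/
def QSof : QS := (n, (Λ.ℓ, (Λ.ℓR, Λ.Lq)))
/-- Suffix parameters of the erasing block. [folklore] -/
def QXof : QX := (n, (Λ.ℓ, (Λ.ℓY, (Λ.ℓR, (Λ.bc, Λ.Lq)))))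

/-- Suffix of the branch block (data length `nℓ + L`). [folklore] -/
def vY : List Bool := CleanBlockInput.suffix (qYE (QYof Λ)) (n * Λ.ℓ + Λ.L)
/-- Suffix of the residue block. [folklore] -/
def vS : List Bool := CleanBlockInput.suffix (qYE (QSof Λ)) (n * Λ.ℓ + Λ.L)
/-- Suffix of the erasing block (data length `regLen + L`). [folklore] -/
def vX : List Bool := CleanBlockInput.suffix (qXE (QXof Λ)) (Λ.regLen + Λ.L)

/-- Data positions of the branch and residue blocks: `X` then `U` (consecutive zone indices). [folklore] -/
def dposD (i : ℕ) : ℕ := Λ.loc i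
/-- Data positions of the erasing block: `Y, S, A` (consecutive), then `U`. [folklore] -/
def dposX (i : ℕ) : ℕ := if i < Λ.regLen then Λ.loc (Λ.oY + i) else Λ.loc (Λ.oU + (i - Λ.regLen))

/-- **The branch block** `Y ⊕= wordY(X)`. [cite: Regev2009, Lemma 3.14 (proof)] -/
def opsY : List (ClOp (Fin W)) :=
  CleanXor.ops Λ.hW eY MY (n * Λ.ℓ + Λ.L) (vY Λ) (dposD Λ) Λ.base (n * Λ.ℓY) fun j => Λ.loc (Λ.oY + j)
/-- **The residue block** `S ⊕= wordS(X)`. [cite: Regev2009, Lemma 3.14 (proof: "compute x mod P(L*) in a second register")] -/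
def opsS : List (ClOp (Fin W)) :=
  CleanXor.ops Λ.hW eS MS (n * Λ.ℓ + Λ.L) (vS Λ) (dposD Λ) Λ.base (n * Λ.ℓR) fun j => Λ.loc (Λ.oS + j)
/-- **The erasing block** `X ⊕= wordX(Y, S, A)`. [cite: Regev2009, Lemma 3.14 (proof: "uncompute the first register")] -/
def opsX : List (ClOp (Fin W)) :=
  CleanXor.ops Λ.hW eX MX (Λ.regLen + Λ.L) (vX Λ) (dposX Λ) Λ.base (n * Λ.ℓ) fun j => Λ.loc j

/-- **The blocks fit**: the three work windows end inside the register. [folklore] -/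
structure Fits : Prop where
  fitY : CleanPlaced.top eY MY (n * Λ.ℓ + Λ.L) (vY Λ) Λ.base ≤ W
  fitS : CleanPlaced.top eS MS (n * Λ.ℓ + Λ.L) (vS Λ) Λ.base ≤ W
  fitX : CleanPlaced.top eX MX (Λ.regLen + Λ.L) (vX Λ) Λ.base ≤ W

section Geom

variable {Λ} (hΛ : Λ.OK)
include hΛ

/-- Geometry of the branch block. [folklore] -/
theorem geomY (hF : Fits Λ) :
    CleanXor.GeomOK W eY MY (n * Λ.ℓ + Λ.L) (vY Λ) (dposD Λ) Λ.base (n * Λ.ℓY) fun j => Λ.loc (Λ.oY + j) := by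
  have hT := Λ.T_eq
  refine
    { inj := fun i j hi hj h => hΛ.loc_inj i j (by omega) (by omega) h
      lt := fun i hi => hΛ.loc_lt i (by omega)
      top_le := hF.fitY
      tinj := fun j j' hj hj' h => by have := hΛ.loc_inj _ _ (by unfold Layout.oY Layout.oU; omega) (by unfold Layout.oY Layout.oU; omega) h; omega
      tlt := fun j hj => (hΛ.loc_lt _ (by unfold Layout.oY Layout.oU; omega)).trans_le hΛ.base_le
      tdata := fun j i hj hi h => by
        have := hΛ.loc_inj _ _ (by unfold Layout.oY Layout.oU; omega) (by omega) h
        unfold Layout.oY Layout.oU at this; omega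
      twin := fun j hj => Or.inl (hΛ.loc_lt _ (by unfold Layout.oY Layout.oU; omega))
      mJJ := by have := hΛ.szY; unfold JJ Sn; omega }

/-- Geometry of the residue block. [folklore] -/
theorem geomS (hF : Fits Λ) :
    CleanXor.GeomOK W eS MS (n * Λ.ℓ + Λ.L) (vS Λ) (dposD Λ) Λ.base (n * Λ.ℓR) fun j => Λ.loc (Λ.oS + j) := by
  have hT := Λ.T_eq
  refine
    { inj := fun i j hi hj h => hΛ.loc_inj i j (by omega) (by omega) h
      lt := fun i hi => hΛ.loc_lt i (by omega)
      top_le := hF.fitS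
      tinj := fun j j' hj hj' h => by
        have := hΛ.loc_inj _ _ (by unfold Layout.oS Layout.oY Layout.oU; omega) (by unfold Layout.oS Layout.oY Layout.oU; omega) h; omega
      tlt := fun j hj => (hΛ.loc_lt _ (by unfold Layout.oS Layout.oY Layout.oU; omega)).trans_le hΛ.base_le
      tdata := fun j i hj hi h => by
        have := hΛ.loc_inj _ _ (by unfold Layout.oS Layout.oY Layout.oU; omega) (by omega) h
        unfold Layout.oS Layout.oY Layout.oU at this; omega
      twin := fun j hj => Or.inl (hΛ.loc_lt _ (by unfold Layout.oS Layout.oY Layout.oU; omega))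
      mJJ := by have := hΛ.szS; unfold JJ Sn; omega }

/-- Geometry of the erasing block. [folklore] -/
theorem geomX (hF : Fits Λ) :
    CleanXor.GeomOK W eX MX (Λ.regLen + Λ.L) (vX Λ) (dposX Λ) Λ.base (n * Λ.ℓ) fun j => Λ.loc j := by
  have hT := Λ.T_eq
  have hR : Λ.regLen = n * Λ.ℓY + n * Λ.ℓR + n * Λ.bc := rfl
  have hval : ∀ i, i < Λ.regLen + Λ.L → ∃ m, m < Λ.T ∧ n * Λ.ℓ ≤ m ∧ dposX Λ i = Λ.loc m ∧
      (i < Λ.regLen → m = Λ.oY + i) ∧ (Λ.regLen ≤ i → m = Λ.oU + (i - Λ.regLen)) := by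
    intro i hi
    unfold dposX
    by_cases h : i < Λ.regLen
    · refine ⟨Λ.oY + i, ?_, ?_, by rw [if_pos h], fun _ => rfl, fun h' => absurd h' (not_le.2 h)⟩
      · unfold Layout.oY Layout.oU; omega
      · unfold Layout.oY Layout.oU; omega
    · refine ⟨Λ.oU + (i - Λ.regLen), ?_, ?_, by rw [if_neg h], fun h' => absurd h' h, fun _ => rfl⟩
      · unfold Layout.oU; omega
      · unfold Layout.oU; omega
  refine
    { inj := fun i j hi hj h => ?_
      lt := fun i hi => by obtain ⟨m, hm, -, e, -⟩ := hval i hi; rw [e]; exact hΛ.loc_lt m hm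
      top_le := hF.fitX
      tinj := fun j j' hj hj' h => hΛ.loc_inj _ _ (by omega) (by omega) h
      tlt := fun j hj => (hΛ.loc_lt _ (by omega)).trans_le hΛ.base_le
      tdata := fun j i hj hi h => by
        obtain ⟨m, hm, hmn, e, -⟩ := hval i hi
        rw [e] at h
        have := hΛ.loc_inj _ _ (by omega) hm h
        omega
      twin := fun j hj => Or.inl (hΛ.loc_lt _ (by omega))
      mJJ := by have := hΛ.szX; unfold JJ Sn; omega }
  obtain ⟨m, hm, -, e, h1, h2⟩ := hval i hi
  obtain ⟨m', hm', -, e', h1', h2'⟩ := hval j hj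
  rw [e, e'] at h
  have hmm := hΛ.loc_inj m m' hm hm' h
  by_cases hi' : i < Λ.regLen <;> by_cases hj' : j < Λ.regLen
  · have := h1 hi'; have := h1' hj'; omega
  · have := h1 hi'; have := h2' (not_lt.1 hj'); unfold Layout.oY at *; omega
  · have := h2 (not_lt.1 hi'); have := h1' hj'; unfold Layout.oY at *; omega
  · have := h2 (not_lt.1 hi'); have := h2' (not_lt.1 hj'); omega

end Geom

/-! ### The oracle and the action of the stage -/

/-- **The query read off a label**: the prefix (first `Lq` wires of the input zone), then the residue table. [cite: Regev2009, Lemma 3.14 (proof)] -/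
def qry (z : QReg W) : Fin Λ.kq → Bool := fun i =>
  if (i : ℕ) < Λ.Lq then z (Λ.fin (Λ.oU + i)) else z (Λ.fin (Λ.oS + ((i : ℕ) - Λ.Lq)))

open Classical in
/-- **The action of the oracle gate**: XOR `f(query)` onto the answer zone. [cite: NielsenChuang2010, §6.1.1] -/
def oracleAct (f : (Fin Λ.kq → Bool) → (Fin (n * Λ.bc) → Bool)) (z : QReg W) : QReg W := fun w =>
  if h : ∃ j : Fin (n * Λ.bc), w = Λ.fin (Λ.oA + j) then z w ^^ f (qry Λ z) h.choose else z w

/-- **The label action of the classical stage**: branch block, residue block, oracle, erasing block, oracle.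
[cite: Regev2009, Lemma 3.14 (proof)] -/
def kappa (f : (Fin Λ.kq → Bool) → (Fin (n * Λ.bc) → Bool)) : QReg W → QReg W :=
  (((oracleAct Λ f ∘ clEval (opsX Λ)) ∘ oracleAct Λ f) ∘ clEval (opsS Λ)) ∘ clEval (opsY Λ)

/-! ### Semantics of the stage -/

section Semantics

variable {Λ}

/-- The window hypothesis of the clean blocks from "everything above the base is clean". [folklore] -/
theorem window_clean (Λ : Layout W n) {z : QReg W} (hzw : ∀ w : Fin W, Λ.base ≤ (w : ℕ) → z w = false) {top : ℕ} (htop : top ≤ W) :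
    ∀ w, Λ.base + w < top → z (finOf W Λ.hW (Λ.base + w)) = false := fun w hw =>
  hzw _ (by rw [val_finOf_of_lt Λ.hW (hw.trans_le htop)]; exact Nat.le_add_right _ _)

/-- Bits of a word as optional entries. [folklore] -/
theorem decide_getElem? (l : List Bool) {j : ℕ} (hj : j < l.length) : decide (l[j]? = some true) = l[j] := by
  rw [List.getElem?_eq_getElem hj]
  cases l[j] <;> simp

/-- Reading a concatenated data word. [folklore] -/
theorem getD_append_of {a b : List Bool} {t : ℕ} :
    (a ++ b).getD t false = if t < a.length then a.getD t false else b.getD (t - a.length) false := by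
  by_cases h : t < a.length
  · rw [if_pos h, List.getD_eq_getElem _ _ (by rw [List.length_append]; omega), List.getElem_append_left h, List.getD_eq_getElem _ _ h]
  · rw [if_neg h]
    push Not at h
    rw [List.getD_eq_getElem?_getD, List.getElem?_append_right h, ← List.getD_eq_getElem?_getD]

variable (hΛ : Λ.OK)
include hΛ

/-- A wire of the form `fin (oA + j)` determines `j`. [folklore] -/
theorem choose_eq {j : Fin (n * Λ.bc)} (h : ∃ j' : Fin (n * Λ.bc), Λ.fin (Λ.oA + j) = Λ.fin (Λ.oA + j')) : h.choose = j := by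
  have e := h.choose_spec
  have hT := Λ.T_eq
  have := Layout.fin_inj hΛ (by unfold Layout.T; omega) (by unfold Layout.T; omega) e
  exact Fin.ext (by omega)

/-- **The oracle on an answer wire.** [cite: NielsenChuang2010, §6.1.1] -/
theorem oracleAct_answer (f : (Fin Λ.kq → Bool) → (Fin (n * Λ.bc) → Bool)) (z : QReg W) (j : Fin (n * Λ.bc)) :
    oracleAct Λ f z (Λ.fin (Λ.oA + j)) = (z (Λ.fin (Λ.oA + j)) ^^ f (qry Λ z) j) := by
  classical
  have h : ∃ j' : Fin (n * Λ.bc), Λ.fin (Λ.oA + j) = Λ.fin (Λ.oA + j') := ⟨j, rfl⟩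
  unfold oracleAct
  rw [dif_pos h, choose_eq hΛ h]

omit hΛ in
/-- **The oracle off the answer zone.** [folklore] -/
theorem oracleAct_of_ne (f : (Fin Λ.kq → Bool) → (Fin (n * Λ.bc) → Bool)) (z : QReg W) (w : Fin W)
    (hw : ∀ j : Fin (n * Λ.bc), w ≠ Λ.fin (Λ.oA + j)) : oracleAct Λ f z w = z w := by
  classical
  unfold oracleAct
  rw [dif_neg (fun ⟨j, hj⟩ => hw j hj)]

set_option maxHeartbeats 1000000 in
/-- **The classical stage on a prepared label.** Let `z` carry the point bits `xb` (`|xb| = nℓ`) on `X`,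
the zone content `uz = F_q ++ ⟨⟨P_all⟩, ε⟩ ++ pad` (`|F_q| = Lq`, `|uz| = L`) on `U`, zeros on `Y, S, A`
and on every wire at or above the base; let the branch and residue words of `xb` have their nominal
lengths. Then after the stage: `Y` holds the branch word, `S` the residue word, `A` is clean, every
wire that is not an `X`, `Y`, `S`, `A` wire is unchanged (in particular `U` and the work window), and `X`
holds `xb ⊕ wordX(branch, residues, f(query))`, the query being `F_q` followed by the residue word.
[cite: Regev2009, Lemma 3.14 (proof)] [cite: NielsenChuang2010, §3.2.5] -/
theorem kappa_spec (hF : Fits Λ) (f : (Fin Λ.kq → Bool) → (Fin (n * Λ.bc) → Bool)) (Pa : PAll) (xb Fq pad : List Bool)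
    (hxb : xb.length = n * Λ.ℓ) (hFq : Fq.length = Λ.Lq) (huz : (zoneOf Fq Pa pad).length = Λ.L)
    (hY : (wordY Pa.1.1 n Λ.ℓ Λ.ℓY xb).length = n * Λ.ℓY) (hS : (wordS Pa.1.1 Pa.1.2 n Λ.ℓ Λ.ℓR xb).length = n * Λ.ℓR)
    (z : QReg W) (hzX : ∀ t, t < n * Λ.ℓ → z (Λ.fin t) = xb.getD t false)
    (hzU : ∀ t, t < Λ.L → z (Λ.fin (Λ.oU + t)) = (zoneOf Fq Pa pad).getD t false)
    (hzR : ∀ t, Λ.oY ≤ t → t < Λ.T → z (Λ.fin t) = false) (hzw : ∀ w : Fin W, Λ.base ≤ (w : ℕ) → z w = false) :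
    let wY := wordY Pa.1.1 n Λ.ℓ Λ.ℓY xb
    let wS := wordS Pa.1.1 Pa.1.2 n Λ.ℓ Λ.ℓR xb
    let q : Fin Λ.kq → Bool := fun i => if (i : ℕ) < Λ.Lq then Fq.getD i false else wS.getD ((i : ℕ) - Λ.Lq) false
    let wX := wordX Pa.1.1.1.2 Pa.1.1.2.2 Pa.1.2 n Λ.ℓ Λ.ℓY Λ.ℓR Λ.bc (wY ++ wS ++ List.ofFn (f q))
    (∀ t, t < n * Λ.ℓ → kappa Λ f z (Λ.fin t) = (xb.getD t false ^^ decide (wX[t]? = some true))) ∧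
    (∀ t, t < n * Λ.ℓY → kappa Λ f z (Λ.fin (Λ.oY + t)) = wY.getD t false) ∧
    (∀ t, t < n * Λ.ℓR → kappa Λ f z (Λ.fin (Λ.oS + t)) = wS.getD t false) ∧
    (∀ j : Fin (n * Λ.bc), kappa Λ f z (Λ.fin (Λ.oA + j)) = false) ∧
    (∀ w : Fin W, (∀ t, t < n * Λ.ℓ → w ≠ Λ.fin t) → (∀ t, Λ.oY ≤ t → t < Λ.T → w ≠ Λ.fin t) → kappa Λ f z w = z w) := by
  intro wY wS q wX
  have hT := Λ.T_eq
  have hoU : Λ.oU = n * Λ.ℓ := rfl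
  have hoY : Λ.oY = n * Λ.ℓ + Λ.L := rfl
  have hoS : Λ.oS = n * Λ.ℓ + Λ.L + n * Λ.ℓY := rfl
  have hoA : Λ.oA = n * Λ.ℓ + Λ.L + n * Λ.ℓY + n * Λ.ℓR := rfl
  have hreg : Λ.regLen = n * Λ.ℓY + n * Λ.ℓR + n * Λ.bc := rfl
  have hkq : Λ.kq = Λ.Lq + n * Λ.ℓR := rfl
  have hLqL := hΛ.Lq_le
  have GY := geomY hΛ hF
  have GS := geomS hΛ hF
  have GX := geomX hΛ hF
  -- distinctness of zone wires
  have hne : ∀ i j, i < Λ.T → j < Λ.T → i ≠ j → Λ.fin i ≠ Λ.fin j := fun i j hi hj hij h => hij (Layout.fin_inj hΛ hi hj h)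
  -- a zone wire is not a `Y`-target / `S`-target / `A`-wire / `X`-target
  have nY : ∀ i, i < Λ.T → (i < Λ.oY ∨ Λ.oS ≤ i) → ∀ j, j < n * Λ.ℓY → Λ.fin i ≠ Λ.fin (Λ.oY + j) :=
    fun i hi hio j hj => hne i _ hi (by omega) (by omega)
  have nS : ∀ i, i < Λ.T → (i < Λ.oS ∨ Λ.oA ≤ i) → ∀ j, j < n * Λ.ℓR → Λ.fin i ≠ Λ.fin (Λ.oS + j) :=
    fun i hi hio j hj => hne i _ hi (by omega) (by omega)
  have nA : ∀ i, i < Λ.oA → ∀ j : Fin (n * Λ.bc), Λ.fin i ≠ Λ.fin (Λ.oA + j) :=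
    fun i hi j => hne i _ (by omega) (by omega) (by omega)
  have nX : ∀ i, i < Λ.T → n * Λ.ℓ ≤ i → ∀ j, j < n * Λ.ℓ → Λ.fin i ≠ Λ.fin j :=
    fun i hi hio j hj => hne i _ hi (by omega) (by omega)
  /- Step 1: the branch block -/
  set z₁ := clEval (opsY Λ) z with hz₁
  obtain ⟨d₁, hd₁⟩ : ∃ d : List Bool, d = xb ++ zoneOf Fq Pa pad := ⟨_, rfl⟩
  have hd₁len : d₁.length = n * Λ.ℓ + Λ.L := by rw [hd₁, List.length_append, hxb, huz]
  have hzd₁ : ∀ i, i < n * Λ.ℓ + Λ.L → z (finOf W Λ.hW (dposD Λ i)) = d₁.getD i false := by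
    intro i hi
    show z (Λ.fin i) = _
    rw [hd₁, getD_append_of, hxb]
    by_cases h : i < n * Λ.ℓ
    · rw [if_pos h, hzX i h]
    · rw [if_neg h]
      have := hzU (i - n * Λ.ℓ) (by omega)
      rwa [show Λ.oU + (i - n * Λ.ℓ) = i by omega] at this
  have h1ne : ∀ w : Fin W, (∀ j, j < n * Λ.ℓY → w ≠ Λ.fin (Λ.oY + j)) → z₁ w = z w := fun w hw =>
    CleanXor.clEval_ops_of_ne GY z w hw
  have h1t : ∀ j, j < n * Λ.ℓY → z₁ (Λ.fin (Λ.oY + j)) = wY.getD j false := by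
    intro j hj
    have hM : MY.OutputsWithin (d₁ ++ vY Λ) (FY (QYof Λ) d₁) (Tn eY (d₁.length + (vY Λ).length)) := by
      have h := MY_spec (QYof Λ) d₁
      rw [List.length_append, hd₁len] at h
      rw [hd₁len]
      exact h
    have hval : FY (QYof Λ) d₁ = wY := by
      rw [QYof, ← hFq, hd₁]; exact FY_eq _ _ _ Fq Pa pad xb hxb
    have key := CleanXor.clEval_ops_target GY d₁ _ hd₁len hM z hzd₁ (window_clean Λ hzw hF.fitY) hj
    rw [hval] at key
    change z₁ (Λ.fin (Λ.oY + j)) = (z (Λ.fin (Λ.oY + j)) ^^ _) at key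
    rw [key, hzR (Λ.oY + j) (Nat.le_add_right _ _) (by omega), Bool.false_xor, List.getD_eq_getElem _ _ (by rw [hY]; exact hj),
      decide_getElem? wY (by rw [hY]; exact hj)]
  have hzw₁ : ∀ w : Fin W, Λ.base ≤ (w : ℕ) → z₁ w = false := fun w hw => by
    rw [h1ne w fun j hj h => ?_, hzw w hw]
    have := Layout.fin_lt_base hΛ (i := Λ.oY + j) (by omega)
    rw [← h] at this; omega
  /- Step 2: the residue block -/
  set z₂ := clEval (opsS Λ) z₁ with hz₂
  have hzd₂ : ∀ i, i < n * Λ.ℓ + Λ.L → z₁ (finOf W Λ.hW (dposD Λ i)) = d₁.getD i false := by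
    intro i hi
    rw [← hzd₁ i hi]
    exact h1ne (Λ.fin i) (nY i (by omega) (Or.inl (by omega)))
  have h2ne : ∀ w : Fin W, (∀ j, j < n * Λ.ℓR → w ≠ Λ.fin (Λ.oS + j)) → z₂ w = z₁ w := fun w hw =>
    CleanXor.clEval_ops_of_ne GS z₁ w hw
  have h2t : ∀ j, j < n * Λ.ℓR → z₂ (Λ.fin (Λ.oS + j)) = wS.getD j false := by
    intro j hj
    have hM : MS.OutputsWithin (d₁ ++ vS Λ) (FS (QSof Λ) d₁) (Tn eS (d₁.length + (vS Λ).length)) := by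
      have h := MS_spec (QSof Λ) d₁
      rw [List.length_append, hd₁len] at h
      rw [hd₁len]
      exact h
    have hval : FS (QSof Λ) d₁ = wS := by
      rw [QSof, ← hFq, hd₁]; exact FS_eq _ _ _ Fq Pa pad xb hxb
    have key := CleanXor.clEval_ops_target GS d₁ _ hd₁len hM z₁ hzd₂ (window_clean Λ hzw₁ hF.fitS) hj
    rw [hval] at key
    change z₂ (Λ.fin (Λ.oS + j)) = (z₁ (Λ.fin (Λ.oS + j)) ^^ _) at key
    rw [key, h1ne (Λ.fin (Λ.oS + j)) (nY _ (by omega) (Or.inr (le_refl _ |>.trans (Nat.le_add_right _ _)))),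
      hzR (Λ.oS + j) (by omega) (by omega), Bool.false_xor,
      List.getD_eq_getElem _ _ (by rw [hS]; exact hj), decide_getElem? wS (by rw [hS]; exact hj)]
  have hzw₂ : ∀ w : Fin W, Λ.base ≤ (w : ℕ) → z₂ w = false := fun w hw => by
    rw [h2ne w fun j hj h => ?_, hzw₁ w hw]
    have := Layout.fin_lt_base hΛ (i := Λ.oS + j) (by omega)
    rw [← h] at this; omega
  /- Step 3: the first oracle call -/
  set z₃ := oracleAct Λ f z₂ with hz₃
  have hq₂ : qry Λ z₂ = q := by
    funext i
    show (if (i : ℕ) < Λ.Lq then z₂ (Λ.fin (Λ.oU + i)) else z₂ (Λ.fin (Λ.oS + ((i : ℕ) - Λ.Lq)))) =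
      (if (i : ℕ) < Λ.Lq then Fq.getD i false else wS.getD ((i : ℕ) - Λ.Lq) false)
    have hi2 : (i : ℕ) < Λ.Lq + n * Λ.ℓR := i.2
    by_cases hi : (i : ℕ) < Λ.Lq
    · rw [if_pos hi, if_pos hi, h2ne (Λ.fin (Λ.oU + i)) (nS _ (by omega) (Or.inl (by omega))),
        h1ne (Λ.fin (Λ.oU + i)) (nY _ (by omega) (Or.inl (by omega))), hzU i (by omega)]
      unfold zoneOf
      rw [getD_append_of, if_pos (by rw [hFq]; exact hi)]
    · rw [if_neg hi, if_neg hi, h2t _ (by omega)]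
  have h3ne : ∀ w : Fin W, (∀ j : Fin (n * Λ.bc), w ≠ Λ.fin (Λ.oA + j)) → z₃ w = z₂ w := fun w hw => oracleAct_of_ne f z₂ w hw
  have h3a : ∀ j : Fin (n * Λ.bc), z₃ (Λ.fin (Λ.oA + j)) = f q j := by
    intro j
    rw [hz₃, oracleAct_answer hΛ, hq₂, h2ne (Λ.fin (Λ.oA + j)) (nS _ (by omega) (Or.inr (Nat.le_add_right _ _))),
      h1ne (Λ.fin (Λ.oA + j)) (nY _ (by omega) (Or.inr (by omega))), hzR (Λ.oA + j) (by omega) (by omega), Bool.false_xor]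
  have hzw₃ : ∀ w : Fin W, Λ.base ≤ (w : ℕ) → z₃ w = false := fun w hw => by
    rw [h3ne w fun j h => ?_, hzw₂ w hw]
    have := Layout.fin_lt_base hΛ (i := Λ.oA + j) (by omega)
    rw [← h] at this; omega
  /- Step 4: the erasing block -/
  set z₄ := clEval (opsX Λ) z₃ with hz₄
  obtain ⟨wreg, hwreg⟩ : ∃ w : List Bool, w = wY ++ wS ++ List.ofFn (f q) := ⟨_, rfl⟩
  have hwlen : wreg.length = n * Λ.ℓY + n * Λ.ℓR + n * Λ.bc := by
    rw [hwreg, List.length_append, List.length_append, hY, hS, List.length_ofFn]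
  obtain ⟨d₃, hd₃⟩ : ∃ d : List Bool, d = wreg ++ zoneOf Fq Pa pad := ⟨_, rfl⟩
  have hd₃len : d₃.length = Λ.regLen + Λ.L := by rw [hd₃, List.length_append, hwlen, huz, hreg]
  -- the register zones `Y, S, A` of `z₃`, read as one word
  have hz₃reg : ∀ i, i < Λ.regLen → z₃ (Λ.fin (Λ.oY + i)) = wreg.getD i false := by
    intro i hi
    rw [hwreg, getD_append_of, List.length_append, hY, hS, getD_append_of, hY]
    by_cases hiY : i < n * Λ.ℓY
    · rw [if_pos (by omega), if_pos hiY, h3ne (Λ.fin (Λ.oY + i)) (nA _ (by omega)),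
        h2ne (Λ.fin (Λ.oY + i)) (nS _ (by omega) (Or.inl (by omega))), h1t i hiY]
    · by_cases hiS : i < n * Λ.ℓY + n * Λ.ℓR
      · rw [if_pos hiS, if_neg hiY, h3ne (Λ.fin (Λ.oY + i)) (nA _ (by omega)),
          show Λ.oY + i = Λ.oS + (i - n * Λ.ℓY) by omega, h2t _ (by omega)]
      · rw [if_neg hiS]
        have hj : i - (n * Λ.ℓY + n * Λ.ℓR) < n * Λ.bc := by omega
        have e : Λ.oY + i = Λ.oA + ((⟨_, hj⟩ : Fin (n * Λ.bc)) : ℕ) := by simp only; omega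
        rw [e, h3a ⟨_, hj⟩, List.getD_eq_getElem _ _ (by rw [List.length_ofFn]; exact hj), List.getElem_ofFn]
  have hzd₃ : ∀ i, i < Λ.regLen + Λ.L → z₃ (finOf W Λ.hW (dposX Λ i)) = d₃.getD i false := by
    intro i hi
    rw [hd₃, getD_append_of, hwlen, ← hreg]
    unfold dposX
    by_cases h : i < Λ.regLen
    · rw [if_pos h, if_pos h]
      exact hz₃reg i h
    · rw [if_neg h, if_neg h]
      show z₃ (Λ.fin (Λ.oU + (i - Λ.regLen))) = _
      rw [h3ne (Λ.fin (Λ.oU + (i - Λ.regLen))) (nA _ (by omega)),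
        h2ne (Λ.fin (Λ.oU + (i - Λ.regLen))) (nS _ (by omega) (Or.inl (by omega))),
        h1ne (Λ.fin (Λ.oU + (i - Λ.regLen))) (nY _ (by omega) (Or.inl (by omega))), hzU _ (by omega)]
  have h4ne : ∀ w : Fin W, (∀ j, j < n * Λ.ℓ → w ≠ Λ.fin j) → z₄ w = z₃ w := fun w hw =>
    CleanXor.clEval_ops_of_ne GX z₃ w hw
  have h4t : ∀ t, t < n * Λ.ℓ → z₄ (Λ.fin t) = (xb.getD t false ^^ decide (wX[t]? = some true)) := by
    intro t ht
    have hM : MX.OutputsWithin (d₃ ++ vX Λ) (FX (QXof Λ) d₃) (Tn eX (d₃.length + (vX Λ).length)) := by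
      have h := MX_spec (QXof Λ) d₃
      rw [List.length_append, hd₃len] at h
      rw [hd₃len]
      exact h
    have hval : FX (QXof Λ) d₃ = wX := by
      rw [QXof, ← hFq, hd₃]
      have e := FX_eq n Λ.ℓ Λ.ℓY Λ.ℓR Λ.bc Fq Pa pad wreg hwlen
      rw [e, hwreg]
    have key := CleanXor.clEval_ops_target GX d₃ _ hd₃len hM z₃ hzd₃ (window_clean Λ hzw₃ hF.fitX) ht
    rw [hval] at key
    change z₄ (Λ.fin t) = (z₃ (Λ.fin t) ^^ _) at key
    rw [key, h3ne (Λ.fin t) (nA _ (by omega)), h2ne (Λ.fin t) (nS _ (by omega) (Or.inl (by omega))),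
      h1ne (Λ.fin t) (nY _ (by omega) (Or.inl (by omega))), hzX t ht]
  /- Step 5: the second oracle call -/
  have hq₄ : qry Λ z₄ = q := by
    rw [← hq₂]
    funext i
    show (if (i : ℕ) < Λ.Lq then z₄ (Λ.fin (Λ.oU + i)) else z₄ (Λ.fin (Λ.oS + ((i : ℕ) - Λ.Lq)))) =
      (if (i : ℕ) < Λ.Lq then z₂ (Λ.fin (Λ.oU + i)) else z₂ (Λ.fin (Λ.oS + ((i : ℕ) - Λ.Lq))))
    have hi2 : (i : ℕ) < Λ.Lq + n * Λ.ℓR := i.2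
    by_cases hi : (i : ℕ) < Λ.Lq
    · rw [if_pos hi, if_pos hi, h4ne (Λ.fin (Λ.oU + i)) (nX _ (by omega) (by omega)), h3ne (Λ.fin (Λ.oU + i)) (nA _ (by omega))]
    · rw [if_neg hi, if_neg hi, h4ne (Λ.fin (Λ.oS + ((i : ℕ) - Λ.Lq))) (nX _ (by omega) (by omega)),
        h3ne (Λ.fin (Λ.oS + ((i : ℕ) - Λ.Lq))) (nA _ (by omega))]
  have hfin : kappa Λ f z = oracleAct Λ f z₄ := rfl
  refine ⟨fun t ht => ?_, fun t ht => ?_, fun t ht => ?_, fun j => ?_, fun w hwX hwR => ?_⟩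
  · rw [hfin, oracleAct_of_ne f z₄ (Λ.fin t) (nA _ (by omega)), h4t t ht]
  · rw [hfin, oracleAct_of_ne f z₄ (Λ.fin (Λ.oY + t)) (nA _ (by omega)), h4ne (Λ.fin (Λ.oY + t)) (nX _ (by omega) (by omega)),
      h3ne (Λ.fin (Λ.oY + t)) (nA _ (by omega)), h2ne (Λ.fin (Λ.oY + t)) (nS _ (by omega) (Or.inl (by omega))), h1t t ht]
  · rw [hfin, oracleAct_of_ne f z₄ (Λ.fin (Λ.oS + t)) (nA _ (by omega)), h4ne (Λ.fin (Λ.oS + t)) (nX _ (by omega) (by omega)),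
      h3ne (Λ.fin (Λ.oS + t)) (nA _ (by omega)), h2t t ht]
  · rw [hfin, oracleAct_answer hΛ, hq₄, h4ne (Λ.fin (Λ.oA + j)) (nX _ (by omega) (by omega)), h3a j, Bool.xor_self]
  · have hwA : ∀ j : Fin (n * Λ.bc), w ≠ Λ.fin (Λ.oA + j) := fun j => hwR _ (by omega) (by omega)
    rw [hfin, oracleAct_of_ne f z₄ w hwA, h4ne w hwX, h3ne w hwA, h2ne w (fun j hj => hwR _ (by omega) (by omega)),
      h1ne w (fun j hj => hwR _ (by omega) (by omega))]

end Semantics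

/-! ### The circuit of the stage -/

section Circuit

variable {Λ} (hΛ : Λ.OK) (hF : Fits Λ)

/-- **The compiled branch block.** [cite: NielsenChuang2010, §3.2.5] -/
def circY : QCircuit cliffordT W := CleanXor.circuit (hN := Λ.hW) (geomY hΛ hF)

/-- **The compiled residue block.** [cite: NielsenChuang2010, §3.2.5] -/
def circS : QCircuit cliffordT W := CleanXor.circuit (hN := Λ.hW) (geomS hΛ hF)

/-- **The compiled erasing block.** [cite: NielsenChuang2010, §3.2.5] -/
def circX : QCircuit cliffordT W := CleanXor.circuit (hN := Λ.hW) (geomX hΛ hF)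

/-- **The matrix of the classical stage** with the oracle gate `O` (acting as `oracleAct f`):
`O · C_X · O · C_S · C_Y`. [cite: Regev2009, Lemma 3.14 (proof)] -/
def stageMat (O : Matrix (QReg W) (QReg W) ℂ) : Matrix (QReg W) (QReg W) ℂ :=
  O * (circX hΛ hF).toMatrix 0 * O * (circS hΛ hF).toMatrix 0 * (circY hΛ hF).toMatrix 0

/-- **The classical stage is a basis map along `kappa`.** [cite: NielsenChuang2010, §3.2.5 and §6.1.1] -/
theorem isBasisMap_stageMat {O : Matrix (QReg W) (QReg W) ℂ} {f : (Fin Λ.kq → Bool) → (Fin (n * Λ.bc) → Bool)}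
    (hO : IsBasisMap O (oracleAct Λ f)) : IsBasisMap (stageMat hΛ hF O) (kappa Λ f) := by
  unfold stageMat kappa circX circS circY
  exact (((hO.mul (CleanXor.isBasisMap_circuit (geomX hΛ hF))).mul hO).mul (CleanXor.isBasisMap_circuit (geomS hΛ hF))).mul
    (CleanXor.isBasisMap_circuit (geomY hΛ hF))

/-- The classical stage is unitary when the oracle gate is. [folklore] -/
theorem stageMat_mem_unitaryGroup {O : Matrix (QReg W) (QReg W) ℂ} (hO : O ∈ Matrix.unitaryGroup (QReg W) ℂ) :
    stageMat hΛ hF O ∈ Matrix.unitaryGroup (QReg W) ℂ := by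
  unfold stageMat
  refine Submonoid.mul_mem _ (Submonoid.mul_mem _ (Submonoid.mul_mem _ (Submonoid.mul_mem _ hO ?_) hO) ?_) ?_
  · exact CleanXor.circuit_mem_unitaryGroup (geomX hΛ hF)
  · exact CleanXor.circuit_mem_unitaryGroup (geomS hΛ hF)
  · exact CleanXor.circuit_mem_unitaryGroup (geomY hΛ hF)

/-- The three compiled blocks are oracle-free. [folklore] -/
theorem circ_isOracleFree : (circY hΛ hF).IsOracleFree ∧ (circS hΛ hF).IsOracleFree ∧ (circX hΛ hF).IsOracleFree :=
  ⟨CleanXor.circuit_isOracleFree _, CleanXor.circuit_isOracleFree _, CleanXor.circuit_isOracleFree _⟩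

end Circuit

end SamplerClassical

end Regev2009

end Literature.Computability.Cryptography

end
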